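import Summits.QuantumFields.YangMills.Theorems.AllWindowsColdBoxBulkMidHarmonicMaxPrincipleFluxDefs

/-!
# LINE-18 «BulkMidWindowSU2» (crux ⟨stmt-QuantumFields-24006⟩): the GAUGE-INVARIANT flux maximum principle K3″
# `DirHarmonicMaxPrincipleFluxInv` — the Prop (definition only)

K3′ `DirHarmonicMaxPrincipleFlux` (registered stub S5 of the v5 skeleton, landed ✓`stub_harmonicMaxPrincipleFlux`) quantifies its
hypothesis over EVERY plaquette key `q : Plaq 4` with four non-free edges — including the keys straddling the outer boundary of the
enlarged box `Λ⁺ = dirCorner + {0,…,2H+2}⁴`, where the circulation of `glue ϑ 0` is a single shell VALUE; so K3′ is not gauge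
invariant (memo `fcl-p3-g34-K3prime-TYPED-VS-INTENDED-24006.md`, evidence #40 on 24006).  The statement the line's later stubs
physically consume is the gauge-invariant one typed here, in the vocabulary of `LatticeMaxwell.formM` (plaquettes of the enlarged
box = `Plaq.shift dirCorner q`, `q ∈ plaquettesIn (halfOpenBox 4 (2H+3))`):

* `DirHarmonicMaxPrincipleFluxInv` (K3″): if every plaquette OF THE ENLARGED BOX whose four edges are pinned (not in
  `dirFreeEdges H`) has `(sCirc (glue ϑ 0) ·)² ≤ B`, then the Maxwell-energy minimiser `glue ϑ (mean ϑ)` has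
  `(sCirc ·)² ≤ c (1 + log H)⁴ B` on every plaquette OF THE ENLARGED BOX.

Both sides are invariant under vertex gauge transformations of the datum on `Λ⁺`.  Definition only (proved in the sibling file
`…BulkMidHarmonicMaxPrincipleFluxInv`); it is NOT a registered stub of the skeleton (the planner of record may re-type S4b/S6/S7
against it).  HONEST LABEL: no stub, crux, rung or summit is proved here; the Yang–Mills mass gap is NOT proved by this file.
-/

set_option autoImplicit false

noncomputable section

open Literature.MathematicalPhysics.QuantumFieldTheory
open Literature.MathematicalPhysics.QuantumFieldTheory.LatticeMaxwell
open Literature.Probability.LatticeModels (halfOpenBox)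
open Summit.QuantumFields.YangMills.Theorems.WeakCouplingRates

namespace Summit.QuantumFields.YangMills.Theorems.AllWindowsColdBoxBulkMidLine

/-- **K3″ — the gauge-invariant flux maximum principle for the harmonic extension** (temporal-gauge Dirichlet problem of the
cold box; hypothesis over the fully pinned plaquettes OF the enlarged box, conclusion over the plaquettes OF the enlarged box). -/
def DirHarmonicMaxPrincipleFluxInv : Prop :=
  ∃ c : ℝ, 0 < c ∧ ∀ H : ℕ, 1 ≤ H → ∀ ϑ : Literature.MathematicalPhysics.QuantumLattice.ZdEdge 4 → ℝ, ∀ B : ℝ,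
    (∀ q ∈ plaquettesIn (halfOpenBox 4 (2 * H + 3)),
        ((Plaq.shift dirCorner q).1, (Plaq.shift dirCorner q).2.1) ∉ dirFreeEdges H →
        ((Plaq.shift dirCorner q).1 + Pi.single (Plaq.shift dirCorner q).2.1 1, (Plaq.shift dirCorner q).2.2) ∉ dirFreeEdges H →
        ((Plaq.shift dirCorner q).1 + Pi.single (Plaq.shift dirCorner q).2.2 1, (Plaq.shift dirCorner q).2.1) ∉ dirFreeEdges H →
        ((Plaq.shift dirCorner q).1, (Plaq.shift dirCorner q).2.2) ∉ dirFreeEdges H →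
        (sCirc (glue (pin := fun e => e ∉ dirFreeEdges H) dirCorner (2 * H + 3) ϑ 0) (Plaq.shift dirCorner q)) ^ 2 ≤ B) →
      ∀ p ∈ plaquettesIn (halfOpenBox 4 (2 * H + 3)),
        (sCirc (glue (pin := fun e => e ∉ dirFreeEdges H) dirCorner (2 * H + 3) ϑ
            (mean (fun e => e ∉ dirFreeEdges H) dirCorner (2 * H + 3) ϑ)) (Plaq.shift dirCorner p)) ^ 2 ≤
          c * (1 + Real.log H) ^ 4 * B

/-- K3′'s hypothesis (all keys with four pinned edges) implies K3″'s hypothesis (the pinned plaquettes of the enlarged box),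
so K3″ yields K3′'s conclusion on the plaquettes of the enlarged box. -/
theorem dirHarmonicMaxPrincipleFluxInv_apply (h : DirHarmonicMaxPrincipleFluxInv) :
    ∃ c : ℝ, 0 < c ∧ ∀ H : ℕ, 1 ≤ H → ∀ ϑ : Literature.MathematicalPhysics.QuantumLattice.ZdEdge 4 → ℝ, ∀ B : ℝ,
    (∀ q : Plaq 4, (q.1, q.2.1) ∉ dirFreeEdges H → (q.1 + Pi.single q.2.1 1, q.2.2) ∉ dirFreeEdges H →
        (q.1 + Pi.single q.2.2 1, q.2.1) ∉ dirFreeEdges H → (q.1, q.2.2) ∉ dirFreeEdges H →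
        (sCirc (glue (pin := fun e => e ∉ dirFreeEdges H) dirCorner (2 * H + 3) ϑ 0) q) ^ 2 ≤ B) →
      ∀ p ∈ plaquettesIn (halfOpenBox 4 (2 * H + 3)),
        (sCirc (glue (pin := fun e => e ∉ dirFreeEdges H) dirCorner (2 * H + 3) ϑ
            (mean (fun e => e ∉ dirFreeEdges H) dirCorner (2 * H + 3) ϑ)) (Plaq.shift dirCorner p)) ^ 2 ≤
          c * (1 + Real.log H) ^ 4 * B := by
  obtain ⟨c, hc, hH⟩ := h
  exact ⟨c, hc, fun H hH1 ϑ B hB p hp => hH H hH1 ϑ B (fun q _ h1 h2 h3 h4 => hB _ h1 h2 h3 h4) p hp⟩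

end Summit.QuantumFields.YangMills.Theorems.AllWindowsColdBoxBulkMidLine

end
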